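import Summits.AtomisticToContinuum.HydrodynamicLimit.Theorems.ImplosionDichotomyHydroLimitProfilewiseBandKcwfQReduction
import Summits.AtomisticToContinuum.HydrodynamicLimit.Theorems.ImplosionDichotomyHydroLimitProfilewiseBandSignedGlue
import HarnessLib

/-!
# Item-level glue over the reduced kinetic input — crux `HydroLimitProfilewiseBand` (stmt-AtomisticToContinuum-17372), line `IdeatorOneSketch` v13

Route `ImplosionDichotomy`, sub-problem `HydrodynamicLimit`; lead prover-line-stmt-AtomisticToContinuum-17372-c8-0 (line cycle 9).
Companion of `…HydroLimitProfilewiseBandKcwfQReduction` (`kcwfQ_of_kcwuSharpPlus`: KCWF-Q ⟸ crux 16659's registered stub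
`KCWUSharpPlus`). The `--glue-by` declarations a planner needs:

* `hydroLimitProfilewiseBand_of_itemInputs` — THIS crux from the five ITEMS SEET (stmt-17701), KCWF-Q (stmt-18052, the route decl
  `OneFlightGossipEngine.KineticCurrentsLDAlongFamiliesQ`), LCTF (stmt-17691), EAT (stmt-17703), CAT (stmt-13734) — every child an item;
  `hydroLimitInBand_of_itemInputs` — the same for the sibling stmt-9133.
* `routeKcwfQ_of_kcwuSharpPlus` — the item stmt-18052 from `KCWUSharpPlus` (so 18052 needs no line of its own).

All proofs are one-liners over landed theorems (p148646 `hydroLimitInBand_of_signedInputs`, p149752 `hydroLimitProfilewiseBand_of_signedInputs`,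
p152422 `kcwfQ_of_kcwuSharpPlus` / `kcwfQ_iff_routeItem`). The composition of skeleton v13 itself (the crux modulo `stub_kcwuSharpPlus` and
`stub_items4`) is `Cruxes/HydroLimitProfilewiseBand/Lines/IdeatorOneSketch.lean: HydroLimitProfilewiseBand_of`.
-/

noncomputable section

open MeasureTheory Set Filter
open scoped ENNReal Topology

namespace Summit.AtomisticToContinuum.HydrodynamicLimit.Theorems.HydroLimitProfilewiseBandKcwfQGlue

open Literature.Analysis.FluidPDE (HardSphereFlow Config localMaxwellian canonicalDensity liouville)
open Literature.MathematicalPhysics.KineticTheory (T3 V3 hsDiameter localGibbsLaw localGibbsMeasure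
  localGibbsProfile)
open Literature.Analysis.FluidPDE Literature.MathematicalPhysics.KineticTheory
open Summit.AtomisticToContinuum.HydrodynamicLimit.Theses
open Summit.AtomisticToContinuum.HydrodynamicLimit.Theorems.HydroLimitProfilewiseBandKcwfQ
  (kcwfQ_of_kcwuSharpPlus kcwfQ_iff_routeItem)
open Summit.AtomisticToContinuum.HydrodynamicLimit.Theorems.HydroLimitInBandSignedBand (hydroLimitInBand_of_signedInputs)
open Summit.AtomisticToContinuum.HydrodynamicLimit.Theorems.HydroLimitProfilewiseBandSignedGlue
  (hydroLimitProfilewiseBand_of_signedInputs)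

/-- **`HydroLimitProfilewiseBand` (stmt-17372) from five ITEMS** — SEET (stmt-17701), KCWF-Q (stmt-18052, route decl), LCTF
(stmt-17691), EAT (stmt-17703), CAT (stmt-13734): the landed five-input glue (p149752) read through `kcwfQ_iff_routeItem`. The
`--glue-by` declaration for splitting THIS crux onto those five items. [folklore] -/
theorem hydroLimitProfilewiseBand_of_itemInputs (hS : OneFlightGossipEngine.SuperExponentialEnergyTails)
    (hQ : OneFlightGossipEngine.KineticCurrentsLDAlongFamiliesQ)
    (hL : OneFlightGossipEngine.LocalClampedTransferLDAlongFamilies) (hE : OneFlightGossipEngine.EnergyActivityTails)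
    (hC : OneFlightGossipEngine.CollisionActivityTails) : ImplosionDichotomy.HydroLimitProfilewiseBand :=
  hydroLimitProfilewiseBand_of_signedInputs hS (kcwfQ_iff_routeItem.1 hQ) hL hE hC

/-- **`HydroLimitInBand` (stmt-9133) from the same five ITEMS** (p148646 read through `kcwfQ_iff_routeItem`): the `--glue-by`
declaration for splitting the sibling crux onto SEET, KCWF-Q (stmt-18052), LCTF, EAT, CAT. [folklore] -/
theorem hydroLimitInBand_of_itemInputs (hS : OneFlightGossipEngine.SuperExponentialEnergyTails)
    (hQ : OneFlightGossipEngine.KineticCurrentsLDAlongFamiliesQ)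
    (hL : OneFlightGossipEngine.LocalClampedTransferLDAlongFamilies) (hE : OneFlightGossipEngine.EnergyActivityTails)
    (hC : OneFlightGossipEngine.CollisionActivityTails) : ImplosionDichotomy.HydroLimitInBand :=
  hydroLimitInBand_of_signedInputs hS (kcwfQ_iff_routeItem.1 hQ) hL hE hC

/-- **stmt-18052 ⟸ `KCWUSharpPlus`**: the route item `OneFlightGossipEngine.KineticCurrentsLDAlongFamiliesQ` (KCWF-Q) follows from
crux 16659's single registered stub (so 18052 needs no line of its own: 14662 ⟸ 16659 ⟸ 18052 ⟸ KCWUSharpPlus). [folklore] -/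
theorem routeKcwfQ_of_kcwuSharpPlus :
    (∃ η₀ : ℝ, 0 < η₀ ∧ ∀ (Θ U C Λ : ℝ), 1 ≤ Θ → 0 ≤ U → 0 ≤ C → 1 ≤ Λ → ∀ σ : ℝ, 0 < σ →
        ∃ β₀ : ℝ, 0 < β₀ ∧
        ∀ (a θ₀ : T3 → ℝ) (u₀ : T3 → V3), Continuous a → Continuous θ₀ → Continuous u₀ →
        (∀ x, Λ⁻¹ ≤ a x ∧ a x ≤ Λ) → (∀ x, Θ⁻¹ ≤ θ₀ x ∧ θ₀ x ≤ Θ) → (∀ x, ‖u₀ x‖ ≤ U) →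
        σ ^ 3 * (⨆ x, a x) ≤ η₀ * ∫ x, a x →
        ∀ Φ : (N : ℕ) →
          HardSphereFlow (Torus.geometry (Fin 3)) (hsDiameter σ N) (N + 1),
        ∀ (A : T3 → Fin 3 → Fin 3 → ℝ) (b : T3 → V3) (G K : T3 × ℝ → ℝ),
        Continuous A → Continuous b → Continuous G → Continuous K →
        ∀ F : T3 × V3 → ℝ, (∀ y, F y =
          (∑ j : Fin 3, ∑ k : Fin 3, A y.1 j k * ((y.2 - u₀ y.1) j * (y.2 - u₀ y.1) k)) +
            (∑ j : Fin 3, b y.1 j * (y.2 - u₀ y.1) j) * G (y.1, ‖y.2 - u₀ y.1‖ ^ 2) +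
            K (y.1, ‖y.2 - u₀ y.1‖ ^ 2)) →
        (∀ y, |F y| ≤ C * (1 + ‖y.2‖ ^ 2)) →
        (∀ x, ∫ v, F (x, v) * localMaxwellian 1 (θ₀ x) (u₀ x) v = 0) →
        (∀ x (j : Fin 3), ∫ v, F (x, v) * v j * localMaxwellian 1 (θ₀ x) (u₀ x) v = 0) →
        (∀ x, ∫ v, F (x, v) * ‖v‖ ^ 2 * localMaxwellian 1 (θ₀ x) (u₀ x) v = 0) →
        ∀ β : ℝ, |β| ≤ β₀ → ∀ ε : ℝ, 0 < ε → ∃ τ₀ : ℝ, 0 < τ₀ ∧ ∀ τ : ℝ, τ₀ ≤ τ →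
        ∃ N₀ : ℕ, ∀ N : ℕ, N₀ ≤ N →
          ∫⁻ z, ENNReal.ofReal (Real.exp (β * ∑ i : Fin (N + 1),
              (τ * ((N : ℝ) + 1) ^ (-(1 / 3 : ℝ)))⁻¹ *
                ∫ r in (0 : ℝ)..(τ * ((N : ℝ) + 1) ^ (-(1 / 3 : ℝ))), F (((Φ N).flow r z) i)))
            ∂(localGibbsLaw σ a u₀ θ₀ N (Φ N)) ≤
          ENNReal.ofReal (Real.exp (ε * ((N : ℝ) + 1)))) →
    Theses.OneFlightGossipEngine.KineticCurrentsLDAlongFamiliesQ := fun h =>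
  kcwfQ_iff_routeItem.2 (kcwfQ_of_kcwuSharpPlus h)

end Summit.AtomisticToContinuum.HydrodynamicLimit.Theorems.HydroLimitProfilewiseBandKcwfQGlue

end
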